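import Summits.ResolutionOfSingularities.ResolutionOfSingularities.Theorems.FrobeniusClosingSteerSwitchRecurrence
import Summits.ResolutionOfSingularities.ResolutionOfSingularities.Theorems.FrobeniusClosingSteerWords12MemberDatum

/-!
# Crux `Steer` (stmt-ResolutionOfSingularities-16345), chain W4.1, (Par-S) hARᵒ slot (H2), sub-slot H2a: a SWITCH PAIR contains a
# CONSECUTIVE switch — a VISIT PAIR `(j₁, j₂)` at which the parameter still exceptional at `j₁` fails at `j₂`
# (res-type-062 g15; blueprint `L/res-type-062/hAR-BLUEPRINT.md` S3; res-L0-w41-tri-1 PREREG-FB v1.6.2 A6 «a late switch is a satellite step»;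
# Theses-free support)

OURS (campaign `res-hironaka`, rung L ★L-G4, slot W4.1; statements about the route's own objects — point steps of a run (`SigmaTopLegality.IsPointStep`),
visit pairs (`Words.IsVisitPair`), the «still exceptional» clause of `SwitchRecurrence.exists_switch_pair_beyond_of_not_persistent`; they replace the
role of no printed item and are NOT statements of the manuscript under review [claim: Hironaka2017, status: under-review]; AI review is weaker than
expert review). Seat res-type-062 g15. Definition-free; pure bookkeeping on ℕ; no Theses file is imported.

## What is proved

(S4) `SwitchRecurrence.exists_switch_pair_beyond_of_not_persistent` delivers point steps `j < j′` and `x` exceptional at `j`, no longer exceptional at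
`j′`. The geometric analysis of (H2) ((R2)/(R4)) reads ONE step: the first visit at which `x` fails. This file extracts it:

* `exists_first_failing_pointStep` — the least point step `j₂ ∈ (j, j′]` at which the clause fails;
* `exists_last_pointStep_before` — the last point step `j₁ ∈ [j, j₂)`;
* **`exists_consecutive_switch`** — `j ≤ j₁ < j₂ ≤ j′`, `IsVisitPair R P j₁ j₂`, the clause HOLDS at `j₁` and FAILS at `j₂`.

[folklore]
-/

-- `Summit.<S>.<S>.…` duplicates the summit name by design (single-problem summit).
set_option linter.dupNamespace false

namespace Summit.ResolutionOfSingularities.ResolutionOfSingularities.Theorems.SwitchingDichotomy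

namespace SwitchVisit

open Summit.ResolutionOfSingularities.ResolutionOfSingularities.Theorems.SwitchingDichotomy.SigmaTopLegality (IsPointStep)
open Summit.ResolutionOfSingularities.ResolutionOfSingularities.Theorems.SwitchingDichotomy.Words (IsVisitPair)

variable {K : Type} [Field K] {O : ValuationSubring K} {R : ℕ → Subring K} {P : (i : ℕ) → Ideal (R i)}

/-- **Consecutive switch inside a switch pair.** Let `Q k` be any predicate on stages («`x` is still an exceptional parameter at `k`»). If `j < j′`
are point steps with `Q j` and `¬ Q j′`, then there is a VISIT PAIR `j₁ < j₂` (consecutive point steps) with `j ≤ j₁`, `j₂ ≤ j′`, `Q j₁`, `¬ Q j₂`.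
[folklore] -/
theorem exists_consecutive_switch' (Q : ℕ → Prop) {j j' : ℕ} (hjj' : j < j') (hpt : IsPointStep R P j) (hpt' : IsPointStep R P j')
    (hQ : Q j) (hQ' : ¬ Q j') :
    ∃ j₁ j₂, j ≤ j₁ ∧ j₂ ≤ j' ∧ IsVisitPair R P j₁ j₂ ∧ Q j₁ ∧ ¬ Q j₂ := by
  classical
  -- the first point step after `j`, up to `j'`, where `Q` fails
  have hex₂ : ∃ k, j < k ∧ IsPointStep R P k ∧ ¬ Q k := ⟨j', hjj', hpt', hQ'⟩
  set j₂ := Nat.find hex₂ with hj₂def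
  obtain ⟨hjj₂, hpt₂, hQ₂⟩ := Nat.find_spec hex₂
  have hj₂le : j₂ ≤ j' := Nat.find_min' hex₂ ⟨hjj', hpt', hQ'⟩
  have hmin₂ : ∀ k, j < k → k < j₂ → IsPointStep R P k → Q k := fun k hjk hkj₂ hptk => by
    by_contra hQk
    exact Nat.find_min hex₂ hkj₂ ⟨hjk, hptk, hQk⟩
  -- the last point step before `j₂` that is `≥ j`
  have hex₁ : ∃ k, j ≤ k ∧ k < j₂ ∧ IsPointStep R P k := ⟨j, le_rfl, hjj₂, hpt⟩
  set j₁ := Nat.findGreatest (fun k => j ≤ k ∧ k < j₂ ∧ IsPointStep R P k) j₂ with hj₁def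
  have hspec₁ : j ≤ j₁ ∧ j₁ < j₂ ∧ IsPointStep R P j₁ := by
    have := Nat.findGreatest_spec (P := fun k => j ≤ k ∧ k < j₂ ∧ IsPointStep R P k) (m := j) (n := j₂) hjj₂.le
      ⟨le_rfl, hjj₂, hpt⟩
    exact this
  obtain ⟨hjj₁, hj₁j₂, hpt₁⟩ := hspec₁
  have hmax₁ : ∀ k, j₁ < k → k < j₂ → ¬ IsPointStep R P k := fun k hj₁k hkj₂ hptk => by
    have hle : k ≤ j₂ := hkj₂.le
    have := Nat.le_findGreatest (P := fun k => j ≤ k ∧ k < j₂ ∧ IsPointStep R P k) hle ⟨hjj₁.trans hj₁k.le, hkj₂, hptk⟩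
    exact absurd this (not_le.mpr hj₁k)
  have hQ₁ : Q j₁ := by
    rcases hjj₁.lt_or_eq with hlt | heq
    · exact hmin₂ j₁ hlt hj₁j₂ hpt₁
    · rw [← heq]; exact hQ
  exact ⟨j₁, j₂, hjj₁, hj₂le, ⟨hj₁j₂, hpt₁, hpt₂, hmax₁⟩, hQ₁, hQ₂⟩

/-- **H2a · consecutive switch of the exceptional parameter.** From (S4)'s switch pair — point steps `j < j′`, `x` an exceptional parameter of step
`j` and NOT «still exceptional» at `j′` (the clause `(∃ hx, ⟨x,hx⟩ ∈ P j′) ∧ ∀ y ∈ P j′, v y ≤ v x`) — a VISIT PAIR `(j₁, j₂)` inside `[j, j′]` at which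
`x` is still exceptional at `j₁` and fails at `j₂` (tri-1 A6: the step after `j₂` is a SATELLITE w.r.t. `V(x)`). [folklore] -/
theorem exists_consecutive_switch {j j' : ℕ} {x : K} (hjj' : j < j') (hpt : IsPointStep R P j) (hpt' : IsPointStep R P j')
    (hx : (∃ hx : x ∈ R j, (⟨x, hx⟩ : R j) ∈ P j) ∧ x ≠ 0 ∧ ∀ y : R j, y ∈ P j → O.valuation (y : K) ≤ O.valuation x)
    (hnot : ¬ ((∃ hx : x ∈ R j', (⟨x, hx⟩ : R j') ∈ P j') ∧
      ∀ y : R j', y ∈ P j' → O.valuation (y : K) ≤ O.valuation x)) :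
    ∃ j₁ j₂, j ≤ j₁ ∧ j₂ ≤ j' ∧ IsVisitPair R P j₁ j₂ ∧
      ((∃ hx : x ∈ R j₁, (⟨x, hx⟩ : R j₁) ∈ P j₁) ∧ ∀ y : R j₁, y ∈ P j₁ → O.valuation (y : K) ≤ O.valuation x) ∧
      ¬ ((∃ hx : x ∈ R j₂, (⟨x, hx⟩ : R j₂) ∈ P j₂) ∧ ∀ y : R j₂, y ∈ P j₂ → O.valuation (y : K) ≤ O.valuation x) :=
  exists_consecutive_switch' (R := R) (P := P)
    (fun k => (∃ hx : x ∈ R k, (⟨x, hx⟩ : R k) ∈ P k) ∧ ∀ y : R k, y ∈ P k → O.valuation (y : K) ≤ O.valuation x)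
    hjj' hpt hpt' ⟨hx.1, hx.2.2⟩ hnot

end SwitchVisit

end Summit.ResolutionOfSingularities.ResolutionOfSingularities.Theorems.SwitchingDichotomy
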